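import Literature.NumberTheory.EllipticCurves.Kato2004.EulerSystemClassNonvanishingProofs
import Literature.NumberTheory.EllipticCurves.PAdicLFunctionNeZeroHoldsProofs
import Literature.NumberTheory.EllipticCurves.ModularSymbolsHeckeProofs
import Mathlib.RingTheory.RootsOfUnity.Complex
import Mathlib.NumberTheory.Cyclotomic.PrimitiveRoots
import HarnessLib

/-!
# Route `ThetaPartnerAtTwo` (TP2), crux K3 `SignedKatoDivisibilityUpToAtTwo` (stmt-BirchSwinnertonDyer-20308 / K3P′ 25631), line
# `colemanrat` v13, assembly brick B2 — VALUE TRANSFER `ℂ → F_k`: Kato's value law (C5) of `ZetaBody` at an EVEN PRIMITIVE character,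
# combined with Birch's formula, as an identity in the cyclotomic field `F_k = ℚ(ζ_{p^k})` (Gauss sums cancelled, `κ ∈ ℚ`)

Width seat `bsd-wall-tp2-p2x-w4` g0 (cell `bsd-wall`), brick B2 of the lead's memo `Cruxes/SignedKatoDivisibilityUpToAtTwo/G7-ASSEMBLY-v1.md`
§0 step 4. HONEST FRAMING: theorems only (no definition, no named fact, no instance, no `sorry`); every statement is CONDITIONAL on a
`ZetaBody` witness (the conclusion of the cite-only fact `Kato2004.exists_eulerSystem_expStar_values`) — nothing about Kato's classes is
asserted; closes no item; K3 / K3P′ are NOT settled and BSD is NOT proved by any of this.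

## What

Kato's (C5) (`ZetaBody`, even clause) at level `m = p^k` reads, for `χ : DirichletCharacter ℂ m` even and complex embeddings `ι_m`:
`Σ_b χ(b) ι_m(σ_b x_{k,∅}) = κ · L_S(f, χ, 1)/Ω⁺_f · R⁻_χ` with `R⁻_χ = cuspFactor f true χ⁻¹ c d a A d′` (four minus symbols). For the
K3 assembly one needs this in the NUMBER FIELD `F = CyclotomicField m ℚ` where `x_{k,∅}` lives, for the `F`-valued even primitive
characters `ψ` (then `j : F → ℚ̄₂` transports it to the `2`-adic side). With `A = p^e` (Kato §13.12: «a power `A` of `p`») the depletion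
`S = prime(m·p·A) = {p}` removes nothing from a conductor-`p^k` character (`twistedLSeries_changeLevel_eq_prod_mul` with an EMPTY
product), Birch's formula `RTSS(ψ_ℂ)·Ω⁺ = τ(ψ_ℂ)·L(f, ψ̄_ℂ, 1)` (`ratTwistedSymbolSum_mul_plusPeriod_holds`) cancels `L(1)/Ω⁺` against the
rational twisted symbol sum and a Gauss sum, and with `ι(ζ_F) = e^{2πi/m}` every term is an `ι`-image: for `κ = q ∈ ℚ` (brick B3,
`KatoConst.exists_ratCast_eq_katoConstant`) injectivity of `ι` gives the identity in `F`.

* §0 `exists_ringHom_zeta_eq_exp`: an embedding `ι : ℚ(ζ_m) → ℂ` with `ι(ζ_m) = e^{2πi/m}` exists (the assembly may CHOOSE the fact's `ι`).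
* §1 transport along `ι` with `ι(ζ_m) = e^{2πi/m}`: `map_zmodChar_eq_stdAddChar`, `map_gaussSum_zmodChar` (`ι(τ_F(ψ)) = τ_ℂ(ψ_ℂ)`,
  `τ_F` w.r.t. `zmodChar m ζ_m`, `τ_ℂ` w.r.t. `stdAddChar`), `map_charSumF` (`ι(Σ_b ψ⁻¹(b)σ_b x) = charSum m ι (ψ⁻¹)_ℂ x`),
  `map_cuspFactorF` (`ι` of the `F`-valued four-cusp factor `= cuspFactor f true ψ_ℂ …`).
* §2 `isDepletedTwistedL_of_prime_pow`: for `m = p^k`, `k ≥ 1`, `A = p^e`, ANY entire continuation of `Σ χ(n)a_n n^{-s}` is a continuation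
  of the `(p·A)`-depleted series (empty Euler product).
* §3 **`charSumF_mul_gaussSum_eq`**: from `ZetaBody W p f ι κ Λ c d a A z x`, `κ = q ∈ ℚ`, `A = p^e`, `1 ≤ k`, guards `(cd, p^k·A) = 1`,
  `dd′ ≡ 1 (A)`, `ι_{p^k}(ζ) = e^{2πi/p^k}`, and `ψ : DirichletCharacter F_{p^k} (p^k)` EVEN PRIMITIVE:
  `(Σ_{b∈(ℤ/p^k)ˣ} ψ⁻¹(b)·σ_b(x_{k,∅})) · τ_F(ψ) = q · ratTwistedSymbolSum f ψ · R⁻_F(ψ)` in `F_{p^k}`,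
  `R⁻_F(ψ) = c²d²[a/A]⁻ − cd²ψ(c)[ac/A]⁻ − c²dψ(d)[ad′/A]⁻ + cdψ(cd)[acd′/A]⁻` (`[·]⁻ = ratMinusSymbol f`, cast to `F`).

References: [Kato2004Asterisque] Thm. 6.6 (1) (p. 163), Thm. 9.7 (p. 189), §6.2 (p. 161), Ex. 13.3 (p. 225), Lemma 13.10 (1) (p. 230), 13.12;
[MazurTateTeitelbaum1986Invent] §I.8 (8.6); [Washington1997] Lemma 4.7–4.8.
-/

set_option autoImplicit false
-- the Theorems namespace of this sub repeats the summit name by design (D-0017 nested layout)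
set_option linter.dupNamespace false
-- `IsCyclotomicExtension {m} ℚ (CyclotomicField m ℚ)` through `NeZero ((m : ℕ) : ℚ)` (as in `EulerSystemValues.sigma`)
set_option backward.isDefEq.respectTransparency false

noncomputable section

open scoped BigOperators NumberField TensorProduct MatrixGroups Real

open CongruenceSubgroup Complex WeierstrassCurve IsDedekindDomain Polynomial
  Literature.NumberTheory.GaloisRepresentations
  Literature.NumberTheory.EllipticCurves Literature.NumberTheory.EllipticCurves.ModularForms
  Literature.NumberTheory.EllipticCurves.Kato2004 Literature.NumberTheory.EllipticCurves.Kato2004.EulerSystemValues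

namespace Summit.BirchSwinnertonDyer.BirchSwinnertonDyer.Theorems.SignedKatoOffTwo.KatoValue

/-! ## §0 Complex embeddings of `ℚ(ζ_m)` normalised at `ζ_m` -/

/-- **An embedding `ι : ℚ(ζ_m) → ℂ` with `ι(ζ_m) = e^{2πi/m}`** (`ζ_m = IsCyclotomicExtension.zeta m ℚ ℚ(ζ_m)`, the root used by
`EulerSystemValues.sigma`): `Φ_m` is irreducible over `ℚ` and `e^{2πi/m}` is a primitive `m`-th root of unity
(`IsPrimitiveRoot.embeddingsEquivPrimitiveRoots`). [cite: Washington1997, Ch. 2 Thm. 2.5] -/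
theorem exists_ringHom_zeta_eq_exp (m : ℕ) [NeZero m] :
    ∃ ι : CyclotomicField m ℚ →+* ℂ,
      ι (IsCyclotomicExtension.zeta m ℚ (CyclotomicField m ℚ)) = Complex.exp (2 * π * I / m) := by
  have hζ := IsCyclotomicExtension.zeta_spec m ℚ (CyclotomicField m ℚ)
  have hirr : Irreducible (cyclotomic m ℚ) := cyclotomic.irreducible_rat (NeZero.pos m)
  have hμ : Complex.exp (2 * π * I / m) ∈ primitiveRoots m ℂ :=
    (mem_primitiveRoots (NeZero.pos m)).mpr (Complex.isPrimitiveRoot_exp m (NeZero.ne m))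
  set φ : CyclotomicField m ℚ →ₐ[ℚ] ℂ := (hζ.embeddingsEquivPrimitiveRoots ℂ hirr).symm ⟨_, hμ⟩ with hφ
  refine ⟨φ.toRingHom, ?_⟩
  have h := congrArg Subtype.val ((hζ.embeddingsEquivPrimitiveRoots ℂ hirr).apply_symm_apply ⟨_, hμ⟩)
  rw [IsPrimitiveRoot.embeddingsEquivPrimitiveRoots_apply_coe] at h
  exact h

/-! ## §1 Transport along a normalised embedding -/

section Transport

variable {m : ℕ} [NeZero m] (ι : CyclotomicField m ℚ →+* ℂ)
  (hι : ι (IsCyclotomicExtension.zeta m ℚ (CyclotomicField m ℚ)) = Complex.exp (2 * π * I / m))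

include hι in
/-- `ι ∘ (a ↦ ζ_m^a) = (a ↦ e^{2πia/m})`: the additive character `zmodChar m ζ_m` maps to Mathlib's `stdAddChar`. [folklore] -/
theorem map_zmodChar_eq_stdAddChar (a : ZMod m) :
    ι (AddChar.zmodChar m (IsCyclotomicExtension.zeta_spec m ℚ (CyclotomicField m ℚ)).pow_eq_one a) =
      ZMod.stdAddChar (N := m) a := by
  rw [AddChar.zmodChar_apply, map_pow, hι, ZMod.stdAddChar_apply, ZMod.toCircle_apply, ← Complex.exp_nat_mul]
  congr 1
  ring

include hι in
/-- **Gauss sums transport**: `ι(Σ_a ψ(a) ζ_m^a) = Σ_a ψ_ℂ(a) e^{2πia/m}`, `ψ_ℂ = ψ.ringHomComp ι`. [cite: Washington1997, Lemma 4.7] -/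
theorem map_gaussSum_zmodChar (ψ : DirichletCharacter (CyclotomicField m ℚ) m) :
    ι (gaussSum ψ (AddChar.zmodChar m (IsCyclotomicExtension.zeta_spec m ℚ (CyclotomicField m ℚ)).pow_eq_one)) =
      gaussSum (ψ.ringHomComp ι) (ZMod.stdAddChar (N := m)) := by
  rw [gaussSum, gaussSum, map_sum]
  refine Finset.sum_congr rfl fun a _ ↦ ?_
  rw [map_mul, MulChar.ringHomComp_apply, map_zmodChar_eq_stdAddChar ι hι]

/-- **Kato's character sum is an `ι`-image**: `ι(Σ_b ψ⁻¹(b) σ_b x) = charSum m ι (ψ⁻¹.ringHomComp ι) x`. [cite: Kato2004Asterisque, Thm. 6.6 (1) (p. 163)] -/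
theorem map_charSumF (ψ : DirichletCharacter (CyclotomicField m ℚ) m) (y : CyclotomicField m ℚ) :
    ι (∑ b : (ZMod m)ˣ, ψ⁻¹ (b : ZMod m) * sigma m b y) = charSum m ι (ψ⁻¹.ringHomComp ι) y := by
  rw [charSum, map_sum]
  refine Finset.sum_congr rfl fun b _ ↦ ?_
  rw [map_mul, MulChar.ringHomComp_apply]

omit [NeZero m] in
/-- **The `F`-valued four-cusp factor maps to Kato's `cuspFactor`** at the character `ψ_ℂ = (ψ⁻¹.ringHomComp ι)⁻¹` (minus symbols,
parity cross-over (P1) of `EulerSystemValues`). [cite: Kato2004Asterisque, Thm. 6.6 (1) (p. 163), Lemma 13.10 (1) (p. 230)] -/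
theorem map_cuspFactorF {N : ℕ} (f : CuspForm (Gamma0 N) 2) (ψ : DirichletCharacter (CyclotomicField m ℚ) m)
    (c d a : ℤ) (A : ℕ) (d' : ℤ) :
    ι (((c : CyclotomicField m ℚ) ^ 2 * (d : CyclotomicField m ℚ) ^ 2) *
            ((ratMinusSymbol f ((a : ℚ) / A) : ℚ) : CyclotomicField m ℚ) -
          ((c : CyclotomicField m ℚ) * (d : CyclotomicField m ℚ) ^ 2) * ψ ((c : ℤ) : ZMod m) *
            ((ratMinusSymbol f ((a * c : ℚ) / A) : ℚ) : CyclotomicField m ℚ) -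
          ((c : CyclotomicField m ℚ) ^ 2 * (d : CyclotomicField m ℚ)) * ψ ((d : ℤ) : ZMod m) *
            ((ratMinusSymbol f ((a * d' : ℚ) / A) : ℚ) : CyclotomicField m ℚ) +
          ((c : CyclotomicField m ℚ) * (d : CyclotomicField m ℚ)) * ψ ((c * d : ℤ) : ZMod m) *
            ((ratMinusSymbol f ((a * c * d' : ℚ) / A) : ℚ) : CyclotomicField m ℚ)) =
      cuspFactor f true (fun n ↦ (ψ⁻¹.ringHomComp ι)⁻¹ (n : ZMod m)) c d a A d' := by
  rw [MulChar.ringHomComp_inv, inv_inv]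
  simp only [cuspFactor, map_add, map_sub, map_mul, map_pow, map_intCast, map_ratCast, MulChar.ringHomComp_apply,
    if_true]

end Transport

/-! ## §2 No depletion at a `p`-power level for a `p`-power auxiliary modulus -/

/-- **`S = {p}` removes nothing**: for `m = p^k` with `k ≥ 1` and `A = p^e`, every entire continuation of `Σ χ(n)a_n n^{-s}` (`χ` mod `m`)
is a continuation of Kato's `(p·A)`-depleted series `L_{prime(m·p·A)}(f, χ, s)` (the Euler product over the primes of `m·p·A` not
dividing `m` is EMPTY). [cite: Kato2004Asterisque, §6.2 (p. 161), 13.12] -/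
theorem isDepletedTwistedL_of_prime_pow {N : ℕ} [NeZero N] {f : CuspForm (Gamma0 N) 2} (hf : IsNewform0 f) (p : ℕ) [Fact p.Prime]
    {m : ℕ} [NeZero m] {k : ℕ} (hk : 1 ≤ k) (hm : m = p ^ k) {A : ℕ} {e : ℕ} (hA : A = p ^ e)
    (χ : DirichletCharacter ℂ m) {L : ℂ → ℂ} (hLd : Differentiable ℂ L)
    (hLs : ∀ s : ℂ, 2 < s.re → L s = twistedLSeries f χ s) :
    IsDepletedTwistedL f m (p * A) χ L := by
  have hp : p.Prime := Fact.out
  haveI : NeZero A := ⟨by rw [hA]; exact pow_ne_zero _ hp.ne_zero⟩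
  haveI : NeZero (p * A) := ⟨mul_ne_zero hp.ne_zero (NeZero.ne A)⟩
  haveI : NeZero (m * (p * A)) := ⟨mul_ne_zero (NeZero.ne m) (NeZero.ne (p * A))⟩
  refine ⟨hLd, fun s hs ↦ ?_⟩
  rw [hLs s hs, twistedLSeries_changeLevel_eq_prod_mul hf (dvd_mul_right m (p * A)) χ hs]
  have hempty : (m * (p * A)).primeFactors.filter (fun q => ¬ q ∣ m) = ∅ := by
    refine Finset.filter_eq_empty_iff.mpr fun q hq hqm ↦ hqm ?_
    have hqp : q.Prime := Nat.prime_of_mem_primeFactors hq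
    have hdvd : q ∣ m * (p * A) := Nat.dvd_of_mem_primeFactors hq
    rw [hm, hA, ← pow_succ', ← pow_add] at hdvd
    rw [hm, (Nat.prime_dvd_prime_iff_eq hqp hp).mp (hqp.dvd_of_dvd_pow hdvd)]
    exact dvd_pow_self p (by omega)
  rw [hempty, Finset.prod_empty, one_mul]

/-! ## §3 The value transfer -/

section Main

variable {W : WeierstrassCurve ℚ} [W.IsElliptic] {N : ℕ} [NeZero N] {f : CuspForm (Gamma0 N) 2}

/-- **VALUE TRANSFER `ℂ → F_{p^k}` (Kato (C5) × Birch, even primitive characters).** Let `f` be the newform of `W`, `p` a prime,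
`ZetaBody W p f ι κ Λ c d a A z x` a Kato witness with `κ = q ∈ ℚ`, `A = p^e`, `k ≥ 1`, `(cd, p^k·A) = 1`, `dd′ ≡ 1 (mod A)`, and assume
the level-`p^k` embedding is normalised, `ι_{p^k}(ζ) = e^{2πi/p^k}` (`ζ = IsCyclotomicExtension.zeta`). Then for every EVEN PRIMITIVE
`F`-valued Dirichlet character `ψ` modulo `p^k` (`F = CyclotomicField (p^k) ℚ`):
`(Σ_{b ∈ (ℤ/p^k)ˣ} ψ⁻¹(b)·σ_b(x_{k,∅})) · τ_F(ψ) = q · ratTwistedSymbolSum f ψ · R⁻_F(ψ)` in `F`, where `τ_F(ψ) = Σ_a ψ(a)ζ^a` and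
`R⁻_F(ψ) = c²d²[a/A]⁻ − cd²ψ(c)[ac/A]⁻ − c²dψ(d)[ad′/A]⁻ + cdψ(cd)[acd′/A]⁻`. Proof: (C5) at `χ := ψ⁻¹_ℂ` (even) with the continuation
`L₀` of `Σ ψ⁻¹_ℂ(n)a_n n^{−s}` (`exists_differentiable_eq_twistedLSeries_holds`; no depletion, §2) gives
`ι(Σψ⁻¹σ x) = κ·L₀(1)/Ω⁺·ι(R⁻_F)`; Birch at `ψ_ℂ` gives `ι(RTSS_F ψ)·Ω⁺ = τ(ψ_ℂ)·L₀(1)` with `τ(ψ_ℂ) = ι(τ_F ψ)` (§1); multiply,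
cancel `Ω⁺ > 0`, and pull back along the injective `ι`. CONDITIONAL on the `ZetaBody` witness.
[cite: Kato2004Asterisque, Thm. 6.6 (1) (p. 163), Thm. 9.7 (p. 189), §6.2 (p. 161)] [cite: MazurTateTeitelbaum1986Invent, §I.8 (8.6)] -/
theorem charSumF_mul_gaussSum_eq (hf : IsNewformOf W f) (p : ℕ) [Fact p.Prime]
    [ContinuousSMul ℤ_[p] (W.tateModule p)] [Module.Free ℤ_[p] (W.tateModule p)] [Module.Finite ℤ_[p] (W.tateModule p)]
    {ι : (m : ℕ) → (CyclotomicField m ℚ →+* ℂ)} {κ : ℝ}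
    {Λ : ∀ (k : ℕ) (r : Finset (HeightOneSpectrum (𝓞 ℚ))),
      H1 (tateRep W p) (cycSubgroup p k r) →ₗ[ℤ_[p]] ℚ_[p] ⊗[ℚ] CyclotomicField (cycLevel p k r) ℚ}
    {c d a : ℤ} {A : ℕ}
    {z : ∀ (k : ℕ) (r : (cyclotomicLevelsRat p (badPlaces c d A N)).Ideals),
      H1 (tateRep W p) ((cyclotomicLevelsRat p (badPlaces c d A N)).level k r.1)}
    {x : ∀ (k : ℕ) (r : (cyclotomicLevelsRat p (badPlaces c d A N)).Ideals),
      CyclotomicField (cycLevel p k r.1) ℚ}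
    (hbody : ZetaBody W p f ι κ Λ c d a A z x) {q : ℚ} (hκ : κ = q)
    {k e : ℕ} (hk : 1 ≤ k) (hA : A = p ^ e) (d' : ℤ)
    (hcd : Int.gcd (c * d) (cycLevel p k (∅ : Finset (HeightOneSpectrum (𝓞 ℚ))) * A) = 1)
    (hdd' : d * d' ≡ 1 [ZMOD (A : ℤ)])
    (hι : ι (cycLevel p k (∅ : Finset (HeightOneSpectrum (𝓞 ℚ))))
        (IsCyclotomicExtension.zeta (cycLevel p k (∅ : Finset (HeightOneSpectrum (𝓞 ℚ)))) ℚ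
          (CyclotomicField (cycLevel p k (∅ : Finset (HeightOneSpectrum (𝓞 ℚ)))) ℚ)) =
      Complex.exp (2 * π * I / (cycLevel p k (∅ : Finset (HeightOneSpectrum (𝓞 ℚ))) : ℕ)))
    (ψ : DirichletCharacter (CyclotomicField (cycLevel p k (∅ : Finset (HeightOneSpectrum (𝓞 ℚ)))) ℚ)
      (cycLevel p k (∅ : Finset (HeightOneSpectrum (𝓞 ℚ)))))
    (hψ : ψ.IsPrimitive) (hev : ψ.Even) :
    (∑ b : (ZMod (cycLevel p k (∅ : Finset (HeightOneSpectrum (𝓞 ℚ)))))ˣ,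
        ψ⁻¹ (b : ZMod _) * sigma (cycLevel p k (∅ : Finset (HeightOneSpectrum (𝓞 ℚ)))) b
          (x k (cyclotomicLevelsRat p (badPlaces c d A N)).idealOne)) *
      gaussSum ψ (AddChar.zmodChar (cycLevel p k (∅ : Finset (HeightOneSpectrum (𝓞 ℚ))))
        (IsCyclotomicExtension.zeta_spec (cycLevel p k (∅ : Finset (HeightOneSpectrum (𝓞 ℚ)))) ℚ
          (CyclotomicField (cycLevel p k (∅ : Finset (HeightOneSpectrum (𝓞 ℚ)))) ℚ)).pow_eq_one) =
    (q : CyclotomicField (cycLevel p k (∅ : Finset (HeightOneSpectrum (𝓞 ℚ)))) ℚ) * ratTwistedSymbolSum f ψ *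
      (((c : CyclotomicField (cycLevel p k ∅) ℚ) ^ 2 * (d : CyclotomicField (cycLevel p k ∅) ℚ) ^ 2) *
            ((ratMinusSymbol f ((a : ℚ) / A) : ℚ) : CyclotomicField (cycLevel p k ∅) ℚ) -
          ((c : CyclotomicField (cycLevel p k ∅) ℚ) * (d : CyclotomicField (cycLevel p k ∅) ℚ) ^ 2) *
            ψ ((c : ℤ) : ZMod _) *
            ((ratMinusSymbol f ((a * c : ℚ) / A) : ℚ) : CyclotomicField (cycLevel p k ∅) ℚ) -
          ((c : CyclotomicField (cycLevel p k ∅) ℚ) ^ 2 * (d : CyclotomicField (cycLevel p k ∅) ℚ)) *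
            ψ ((d : ℤ) : ZMod _) *
            ((ratMinusSymbol f ((a * d' : ℚ) / A) : ℚ) : CyclotomicField (cycLevel p k ∅) ℚ) +
          ((c : CyclotomicField (cycLevel p k ∅) ℚ) * (d : CyclotomicField (cycLevel p k ∅) ℚ)) *
            ψ ((c * d : ℤ) : ZMod _) *
            ((ratMinusSymbol f ((a * c * d' : ℚ) / A) : ℚ) : CyclotomicField (cycLevel p k ∅) ℚ)) := by
  have hp : p.Prime := Fact.out
  have hm : cycLevel p k (∅ : Finset (HeightOneSpectrum (𝓞 ℚ))) = p ^ k := by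
    rw [cycLevel, Finset.prod_empty, mul_one]
  -- the complex characters: `χ := ψ⁻¹_ℂ` (Kato's), `ψ_ℂ := ψ.ringHomComp ι` (Birch's), `ψ_ℂ⁻¹ = χ`
  set ψC : DirichletCharacter ℂ (cycLevel p k (∅ : Finset (HeightOneSpectrum (𝓞 ℚ)))) :=
    ψ.ringHomComp (ι (cycLevel p k (∅ : Finset (HeightOneSpectrum (𝓞 ℚ))))) with hψC
  set χ : DirichletCharacter ℂ (cycLevel p k (∅ : Finset (HeightOneSpectrum (𝓞 ℚ)))) :=
    ψ⁻¹.ringHomComp (ι (cycLevel p k (∅ : Finset (HeightOneSpectrum (𝓞 ℚ))))) with hχ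
  have hχinv : ψC⁻¹ = χ := by rw [hψC, hχ, MulChar.ringHomComp_inv]
  have hψCprim : ψC.IsPrimitive := (isPrimitive_ringHomComp_iff _ ψ).mpr hψ
  have hψCeven : ψC.Even := (even_ringHomComp_iff _ ψ).mpr hev
  have hχeven : χ (-1) = 1 := by
    have h1 : ψC (-1) = 1 := hψCeven
    rw [← hχinv, MulChar.inv_apply_eq_inv, h1, Ring.inverse_one]
  -- the continuation of `L(f, χ, s)` (no depletion at `S = {p}`)
  obtain ⟨L₀, hL₀d, hL₀s⟩ := exists_differentiable_eq_twistedLSeries_holds f χ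
  have hdep : IsDepletedTwistedL f (cycLevel p k (∅ : Finset (HeightOneSpectrum (𝓞 ℚ)))) (p * A) χ L₀ :=
    isDepletedTwistedL_of_prime_pow hf.1 p hk hm hA χ hL₀d hL₀s
  -- Kato (C5), even clause
  obtain ⟨-, -, -, -, -, hC5⟩ := hbody
  have hK : charSum (cycLevel p k (∅ : Finset (HeightOneSpectrum (𝓞 ℚ)))) (ι (cycLevel p k (∅ : Finset (HeightOneSpectrum (𝓞 ℚ)))))
      χ (x k (cyclotomicLevelsRat p (badPlaces c d A N)).idealOne) =
      κ * (L₀ 1 / (plusPeriod f : ℂ)) *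
        cuspFactor f true (fun n ↦ χ⁻¹ (n : ZMod (cycLevel p k (∅ : Finset (HeightOneSpectrum (𝓞 ℚ)))))) c d a A d' :=
    (hC5 k (cyclotomicLevelsRat p (badPlaces c d A N)).idealOne d' χ L₀ hcd hdd' hdep).1 hχeven
  -- Birch at `ψ_ℂ`
  have hB := ratTwistedSymbolSum_mul_plusPeriod_holds (f := f) hf.1 hf.coeffField_eq_bot hψCprim hψCeven hL₀d
    (fun s hs ↦ by rw [hχinv]; exact hL₀s s hs)
  -- everything is an `ι`-image
  have hΩ : (plusPeriod f : ℂ) ≠ 0 := by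
    exact_mod_cast (IsNewform0.plusPeriod_pos_holds hf.1 hf.coeffField_eq_bot).ne'
  have hcs := map_charSumF (ι (cycLevel p k (∅ : Finset (HeightOneSpectrum (𝓞 ℚ))))) ψ
    (x k (cyclotomicLevelsRat p (badPlaces c d A N)).idealOne)
  have hgs := map_gaussSum_zmodChar (ι (cycLevel p k (∅ : Finset (HeightOneSpectrum (𝓞 ℚ))))) hι ψ
  have hcf := map_cuspFactorF (ι (cycLevel p k (∅ : Finset (HeightOneSpectrum (𝓞 ℚ))))) f ψ c d a A d'
  have hrt : ratTwistedSymbolSum f ψC = ι (cycLevel p k (∅ : Finset (HeightOneSpectrum (𝓞 ℚ)))) (ratTwistedSymbolSum f ψ) :=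
    ratTwistedSymbolSum_ringHomComp _ f ψ
  apply (ι (cycLevel p k (∅ : Finset (HeightOneSpectrum (𝓞 ℚ))))).injective
  rw [map_mul, hcs, hgs, map_mul, map_mul, hcf, map_ratCast, ← hrt, hK, hκ]
  -- `κ·(L₀(1)/Ω⁺)·R · τ = q · RTSS · R` from Birch `RTSS·Ω⁺ = τ·L₀(1)`
  have hB' : ratTwistedSymbolSum f ψC =
      gaussSum ψC (ZMod.stdAddChar (N := cycLevel p k (∅ : Finset (HeightOneSpectrum (𝓞 ℚ))))) * L₀ 1 / (plusPeriod f : ℂ) := by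
    rw [eq_div_iff hΩ, hB]
  rw [hB']
  push_cast
  field_simp
  ring

end Main

end Summit.BirchSwinnertonDyer.BirchSwinnertonDyer.Theorems.SignedKatoOffTwo.KatoValue

end
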